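import Summits.CriticalPhenomena.CardyFormulaZ2.Theorems.CardyIKTransportIKLinearTransportDXCore2

/-!
# Pinned diagram exchange on cylinders — core part 3 (generic, Mathlib-only)

Helper file toward the stub `stub_DiagramExchange` of the line `pinned-diagram-exchange` (crux
stmt-CriticalPhenomena-5076): the pinned Yang–Baxter identity `DiagramExchangeAt L` on all cylinders `ℤ/L`, `L ≥ 3`,
by a train argument in the coloured partition category (see the final file for the overview).

PART 3: the window lemma (two necklaces differing by a kernel-checked window identity have proportional pinned
weights), cyclicity (rotation invariance), and the start necklace of the bridge.
-/

namespace Summit.CriticalPhenomena.CardyFormulaZ2.Theorems.IKLinearTransport.PinnedDiagramExchange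

namespace DX

open SimpleGraph

section Necklace

variable {L : ℕ}

/-! ### The window lemma -/

/-- Template embedding of the seven hexagon vertices at position `j` with lower row `r`. [folklore] -/
def φ (j : Fin (L + 2)) (r : ZMod L) : Fin 7 → Vx L :=
  ![Sum.inl (0, r), Sum.inl (2, r), Sum.inl (0, r + 1), Sum.inl (2, r + 1),
    Sum.inr j, Sum.inr (j + 1 + 1), Sum.inr (j + 1)]

/-- `j + 2 ≠ j` in `Fin (L+2)` for `L ≥ 3`. [folklore] -/
theorem two_ne (hL : 3 ≤ L) (j : Fin (L + 2)) : j + 1 + 1 ≠ j := by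
  intro h
  rw [add_assoc] at h
  have h3 := congrArg Fin.val (add_eq_left.mp h)
  rw [Fin.val_add, Fin.val_one, Fin.val_zero, Nat.mod_eq_of_lt (by omega)] at h3
  omega

/-- `r + 1 ≠ r` in `ZMod L` for `L ≥ 3`. [folklore] -/
theorem row_succ_ne (hL : 3 ≤ L) (r : ZMod L) : r + 1 ≠ r := by
  haveI : Fact (1 < L) := ⟨by omega⟩
  intro h
  exact one_ne_zero (add_eq_left.mp h)

/-- The template embedding is injective (`L ≥ 3`). [folklore] -/
theorem φ_injective (hL : 3 ≤ L) (j : Fin (L + 2)) (r : ZMod L) : Function.Injective (φ j r) := by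
  have h1 := succ_ne j
  have h2 := two_ne hL j
  have h3 := succ_ne (j + 1)
  have h4 := row_succ_ne hL r
  have h5 : (0 : Fin 3) ≠ 2 := by decide
  rw [← List.nodup_ofFn]
  simp [φ, List.ofFn_succ, Fin.succ, h3, h5, h1.symm, h2.symm, h4.symm, h5.symm]

/-- A template vertex is a boundary vertex or the interior one. [folklore] -/
theorem φ_cases (j : Fin (L + 2)) (r : ZMod L) (a : Fin 7) :
    φ j r a ∈ Set.range (fun b : Fin 6 => φ j r b.castSucc) ∨ φ j r a = φ j r 6 := by
  rcases Fin.eq_castSucc_or_eq_last a with ⟨b, rfl⟩ | rfl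
  · exact Or.inl ⟨b, rfl⟩
  · exact Or.inr rfl

/-- The six boundary colours of the window at `j` (lower row `r`) in the off-window configuration `o`,
fed to a function of six Booleans. [folklore] -/
def cb6 {α : Type*} (f : Bool → Bool → Bool → Bool → Bool → Bool → α) (ξ ζ : ZMod L → Bool)
    (j : Fin (L + 2)) (r : ZMod L) (o : Cfg L) : α :=
  f (ξ r) (ζ r) (ξ (r + 1)) (ζ (r + 1)) (o.1 j) (o.1 (j + 1 + 1))

/-- The window graph in template form. [folklore] -/
def Wn (d : WinDesc) (ξ ζ : ZMod L → Bool) (j : Fin (L + 2)) (r : ZMod L) (o : Cfg L) (x : WinIn) :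
    SimpleGraph (Vx L) :=
  fromRel fun u v => ∃ a b, u = φ j r a ∧ v = φ j r b ∧ (a, b) ∈ cb6 (winE d) ξ ζ j r o x

/-- GRAPH FACTORISATION at a window: template part `⊔` rest. [folklore] -/
theorem neckG_ins (hL : 3 ≤ L) (nk : Neck L) (ξ ζ : ZMod L → Bool) (j : Fin (L + 2)) (d : WinDesc)
    (hlo : (nk j).kind = d.lo) (hhi : (nk (j + 1)).kind = d.hi)
    (hrow : (d.shift = false ∧ (nk (j + 1)).row = (nk j).row) ∨
      (d.shift = true ∧ d.hi = Kind.R ∧ (nk (j + 1)).row = (nk j).row + 1))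
    (o : Cfg L) (x : WinIn) :
    neckG nk ξ ζ (ins j o x) (fun _ => True) =
      Wn d ξ ζ j (nk j).row o x ⊔ neckG nk ξ ζ o (fun i => ¬ (i = j ∨ i = j + 1)) := by
  rw [neckG_split nk ξ ζ (ins j o x) (fun i => i = j ∨ i = j + 1), neckG_rest_ins]
  congr 1
  have hj := succ_ne j
  have hj' := succ_ne (j + 1)
  have hj2 := two_ne hL j
  -- the two window pieces in template form
  have e1 : pEdges ξ ζ (nk j) ((ins j o x).1 j) ((ins j o x).1 (j + 1)) ((ins j o x).2 j)
      (Sum.inr j) (Sum.inr (j + 1)) =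
      (pieceE d.lo (ξ (nk j).row) (ζ (nk j).row) (ξ ((nk j).row + 1)) (ζ ((nk j).row + 1))
        (o.1 j) x.1 x.2.1 0 1 2 3 4 6).map (Prod.map (φ j (nk j).row) (φ j (nk j).row)) := by
    rw [pieceE_map]
    simp only [pEdges, hlo, ins, hj.symm, ↓reduceIte]
    rfl
  have e2 : pEdges ξ ζ (nk (j + 1)) ((ins j o x).1 (j + 1)) ((ins j o x).1 (j + 1 + 1))
      ((ins j o x).2 (j + 1)) (Sum.inr (j + 1)) (Sum.inr (j + 1 + 1)) =
      (if d.shift then pieceE d.hi (ξ ((nk j).row + 1)) (ζ ((nk j).row + 1)) (ξ ((nk j).row + 1))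
          (ζ ((nk j).row + 1)) x.1 (o.1 (j + 1 + 1)) x.2.2 2 3 2 3 6 5
        else pieceE d.hi (ξ (nk j).row) (ζ (nk j).row) (ξ ((nk j).row + 1)) (ζ ((nk j).row + 1))
          x.1 (o.1 (j + 1 + 1)) x.2.2 0 1 2 3 6 5).map (Prod.map (φ j (nk j).row) (φ j (nk j).row)) := by
    rcases hrow with ⟨hs, hr⟩ | ⟨hs, hR, hr⟩
    · simp only [hs, pEdges, hhi, hr, ins, hj, hj', ↓reduceIte, Bool.false_eq_true, pieceE_map]
      rfl
    · simp only [hs, pEdges, hhi, hR, hr, ins, hj, hj', ↓reduceIte, pieceE_map]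
      rfl
  ext u v
  simp only [neckG, neckE, Wn, cb6, winE, Set.mem_setOf_eq, fromRel_adj]
  have key : ∀ u v : Vx L, (∃ i, (i = j ∨ i = j + 1) ∧ (u, v) ∈ pEdges ξ ζ (nk i) ((ins j o x).1 i)
      ((ins j o x).1 (i + 1)) ((ins j o x).2 i) (Sum.inr i) (Sum.inr (i + 1))) ↔
      ∃ a b, u = φ j (nk j).row a ∧ v = φ j (nk j).row b ∧ (a, b) ∈
        pieceE d.lo (ξ (nk j).row) (ζ (nk j).row) (ξ ((nk j).row + 1)) (ζ ((nk j).row + 1))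
          (o.1 j) x.1 x.2.1 0 1 2 3 4 6 ++
        (if d.shift then pieceE d.hi (ξ ((nk j).row + 1)) (ζ ((nk j).row + 1)) (ξ ((nk j).row + 1))
          (ζ ((nk j).row + 1)) x.1 (o.1 (j + 1 + 1)) x.2.2 2 3 2 3 6 5
        else pieceE d.hi (ξ (nk j).row) (ζ (nk j).row) (ξ ((nk j).row + 1)) (ζ ((nk j).row + 1))
          x.1 (o.1 (j + 1 + 1)) x.2.2 0 1 2 3 6 5) := by
    intro u v
    constructor
    · rintro ⟨i, (rfl | rfl), h⟩
      · rw [e1, List.mem_map] at h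
        obtain ⟨⟨a, b⟩, hab, he⟩ := h
        simp only [Prod.map_apply, Prod.mk.injEq] at he
        exact ⟨a, b, he.1.symm, he.2.symm, List.mem_append_left _ hab⟩
      · rw [e2, List.mem_map] at h
        obtain ⟨⟨a, b⟩, hab, he⟩ := h
        simp only [Prod.map_apply, Prod.mk.injEq] at he
        exact ⟨a, b, he.1.symm, he.2.symm, List.mem_append_right _ hab⟩
    · rintro ⟨a, b, rfl, rfl, h⟩
      rcases List.mem_append.1 h with h | h
      · refine ⟨j, Or.inl rfl, ?_⟩
        rw [e1, List.mem_map]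
        exact ⟨(a, b), h, rfl⟩
      · refine ⟨j + 1, Or.inr rfl, ?_⟩
        rw [e2, List.mem_map]
        exact ⟨(a, b), h, rfl⟩
  rw [key u v, key v u]

/-- WEIGHT FACTORISATION at a window. [folklore] -/
theorem neckW_ins' (nk : Neck L) (ξ ζ : ZMod L → Bool) (j : Fin (L + 2)) (d : WinDesc)
    (hlo : (nk j).kind = d.lo) (hhi : (nk (j + 1)).kind = d.hi)
    (hrow : (d.shift = false ∧ (nk (j + 1)).row = (nk j).row) ∨
      (d.shift = true ∧ d.hi = Kind.R ∧ (nk (j + 1)).row = (nk j).row + 1))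
    (o : Cfg L) (x : WinIn) :
    neckW nk ξ ζ (ins j o x) = cb6 (winW d) ξ ζ j (nk j).row o x * wRest nk ξ ζ j o := by
  rw [neckW_ins]
  congr 1
  simp only [cb6, winW, pW, hlo, hhi]
  rcases hrow with ⟨hs, hr⟩ | ⟨hs, hR, hr⟩
  · simp [hs, hr]
  · simp only [hs, hR, hr, ↓reduceIte]
    rfl

/-- The rest avoids the interior template vertex. [folklore] -/
theorem rest_avoids (nk : Neck L) (ξ ζ : ZMod L → Bool) (j : Fin (L + 2)) (r : ZMod L) (o : Cfg L)
    (v : Vx L) : ¬ (neckG nk ξ ζ o (fun i => ¬ (i = j ∨ i = j + 1))).Adj (φ j r 6) v := by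
  rintro ⟨-, h | h⟩ <;>
  · obtain ⟨i, hi, he⟩ := h
    have hv := pieceE_verts _ _ _ _ _ _ _ _ _ _ _ _ _ _ _ he
    simp only [φ, Matrix.cons_val] at hv
    push_cast [not_or] at hi
    rcases hv with ⟨h1, h2⟩
    first
    | (rcases h1 with h | h | h | h | h | h <;>
        first | exact Sum.inr_ne_inl h | (exact hi.2 (Sum.inr_injective h).symm) |
          (exact hi.1 (add_right_cancel (Sum.inr_injective h)).symm))
    | (rcases h2 with h | h | h | h | h | h <;>
        first | exact Sum.inr_ne_inl h | (exact hi.2 (Sum.inr_injective h).symm) |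
          (exact hi.1 (add_right_cancel (Sum.inr_injective h)).symm))

/-- Window edges stay on the template. [folklore] -/
theorem Wn_verts (d : WinDesc) (ξ ζ : ZMod L → Bool) (j : Fin (L + 2)) (r : ZMod L) (o : Cfg L)
    (x : WinIn) (u v : Vx L) (h : (Wn d ξ ζ j r o x).Adj u v) :
    (u ∈ Set.range (fun b : Fin 6 => φ j r b.castSucc) ∨ u = φ j r 6) ∧
    (v ∈ Set.range (fun b : Fin 6 => φ j r b.castSucc) ∨ v = φ j r 6) := by
  rcases h with ⟨-, ⟨a, b, rfl, rfl, -⟩ | ⟨a, b, rfl, rfl, -⟩⟩ <;> exact ⟨φ_cases j r _, φ_cases j r _⟩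

/-- Signature relation on template vertices, as a set of vertex pairs. [folklore] -/
def PsigS (j : Fin (L + 2)) (r : ZMod L) (σ : List ℕ) : Set (Vx L × Vx L) :=
  {e | ∃ a b : Fin 6, e.1 = φ j r a.castSucc ∧ e.2 = φ j r b.castSucc ∧ (σ.getD a.val 0).testBit b.val = true}

/-- Template reachability of a window is read off the certified signature. [folklore] -/
theorem Wn_reach (hL : 3 ≤ L) (d : WinDesc) (ξ ζ : ZMod L → Bool) (j : Fin (L + 2)) (r : ZMod L)
    (o : Cfg L) (x : WinIn)
    (hsig : ∀ a b : Fin 6, (H (cb6 (winE d) ξ ζ j r o x)).Reachable a.castSucc b.castSucc ↔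
      ((sig (cb6 (winE d) ξ ζ j r o x)).getD a.val 0).testBit b.val = true) :
    ∀ s ∈ Set.range (fun b : Fin 6 => φ j r b.castSucc), ∀ s' ∈ Set.range (fun b : Fin 6 => φ j r b.castSucc),
      (Wn d ξ ζ j r o x).Reachable s s' ↔ (s, s') ∈ PsigS j r (sig (cb6 (winE d) ξ ζ j r o x)) := by
  rintro s ⟨a, rfl⟩ s' ⟨b, rfl⟩
  have hinj := φ_injective hL j r
  rw [Wn, reach_map_iff (φ j r) hinj (fun a b => (a, b) ∈ cb6 (winE d) ξ ζ j r o x)]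
  change (H _).Reachable _ _ ↔ _
  rw [hsig, PsigS, Set.mem_setOf_eq]
  constructor
  · intro h; exact ⟨a, b, rfl, rfl, h⟩
  · rintro ⟨a', b', ha, hb, h⟩
    have ha' : a = a' := Fin.castSucc_injective _ (hinj ha)
    have hb' : b = b' := Fin.castSucc_injective _ (hinj hb)
    subst ha' hb'
    exact h

/-- A weight with nonzero real image is nonzero. [folklore] -/
theorem toR_ne_zero {w : ℤ√3} (h : toR w ≠ 0) : w ≠ 0 := by
  rintro rfl; exact h (map_zero _)

/-- THE WINDOW LEMMA. Two necklaces that agree off the positions `j, j+1` and whose windows there are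
instances of a kernel-checked identity `κ·[dL] ≡ κ'·[dR]` have proportional pinned weights. [folklore] -/
theorem window (hL : 3 ≤ L) (nk nk' : Neck L) (ξ ζ : ZMod L → Bool) (j : Fin (L + 2))
    (dL dR : WinDesc) (κ κ' : ℤ√3)
    (hck : ∀ c0 c1 c2 c3 c4 c5, checkCb dL dR κ κ' c0 c1 c2 c3 c4 c5 = true)
    (hagree : ∀ i, ¬ (i = j ∨ i = j + 1) → nk i = nk' i)
    (hlo : (nk j).kind = dL.lo) (hhi : (nk (j + 1)).kind = dL.hi)
    (hrow : (dL.shift = false ∧ (nk (j + 1)).row = (nk j).row) ∨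
      (dL.shift = true ∧ dL.hi = Kind.R ∧ (nk (j + 1)).row = (nk j).row + 1))
    (hlo' : (nk' j).kind = dR.lo) (hhi' : (nk' (j + 1)).kind = dR.hi)
    (hrow' : (dR.shift = false ∧ (nk' (j + 1)).row = (nk' j).row) ∨
      (dR.shift = true ∧ dR.hi = Kind.R ∧ (nk' (j + 1)).row = (nk' j).row + 1))
    (hr : (nk' j).row = (nk j).row) (Δ : Set ((Fin 2 × ZMod L) × (Fin 2 × ZMod L))) :
    toR κ * pinnedN nk ξ ζ Δ = toR κ' * pinnedN nk' ξ ζ Δ := by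
  classical
  unfold pinnedN
  rw [sum_split j, sum_split j, Finset.mul_sum, Finset.mul_sum]
  refine Finset.sum_congr rfl fun o _ => ?_
  have hRest : neckG nk' ξ ζ o (fun i => ¬ (i = j ∨ i = j + 1)) =
      neckG nk ξ ζ o (fun i => ¬ (i = j ∨ i = j + 1)) := by
    ext u v
    simp only [neckG, neckE, Set.mem_setOf_eq, fromRel_adj]
    constructor <;> rintro ⟨hne, h⟩ <;> refine ⟨hne, ?_⟩ <;>
      rcases h with ⟨i, hi, h⟩ | ⟨i, hi, h⟩
    · exact Or.inl ⟨i, hi, by rwa [hagree i hi]⟩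
    · exact Or.inr ⟨i, hi, by rwa [hagree i hi]⟩
    · exact Or.inl ⟨i, hi, by rwa [← hagree i hi]⟩
    · exact Or.inr ⟨i, hi, by rwa [← hagree i hi]⟩
  have hwRest : wRest nk' ξ ζ j o = wRest nk ξ ζ j o := by
    unfold wRest
    refine Finset.prod_congr rfl fun i hi => ?_
    simp only [Finset.mem_compl, Finset.mem_insert, Finset.mem_singleton] at hi
    rw [hagree i hi]
  -- summands in factorised form
  have hsum : ∀ (nk₀ : Neck L) (d : WinDesc), (nk₀ j).kind = d.lo → (nk₀ (j + 1)).kind = d.hi →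
      ((d.shift = false ∧ (nk₀ (j + 1)).row = (nk₀ j).row) ∨
        (d.shift = true ∧ d.hi = Kind.R ∧ (nk₀ (j + 1)).row = (nk₀ j).row + 1)) →
      ∑ x : WinIn, (if diagOf (neckG nk₀ ξ ζ (ins j o x) fun _ => True) = Δ
          then toR (neckW nk₀ ξ ζ (ins j o x)) else 0) =
      (∑ x : WinIn, (if {pq : (Fin 2 × ZMod L) × (Fin 2 × ZMod L) |
          (Wn d ξ ζ j (nk₀ j).row o x ⊔ neckG nk₀ ξ ζ o (fun i => ¬ (i = j ∨ i = j + 1))).Reachable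
            (Sum.inl (bcell pq.1)) (Sum.inl (bcell pq.2))} = Δ
          then toR (cb6 (winW d) ξ ζ j (nk₀ j).row o x) else 0)) * toR (wRest nk₀ ξ ζ j o) := by
    intro nk₀ d h1 h2 h3
    rw [Finset.sum_mul]
    refine Finset.sum_congr rfl fun x _ => ?_
    rw [neckG_ins hL nk₀ ξ ζ j d h1 h2 h3, neckW_ins' nk₀ ξ ζ j d h1 h2 h3, map_mul]
    simp only [diagOf]
    split_ifs <;> ring
  rw [hsum nk dL hlo hhi hrow, hsum nk' dR hlo' hhi' hrow', ← mul_assoc, ← mul_assoc, hwRest, hRest, hr]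
  congr 1
  -- the substitution lemma
  refine subst_sum (Set.range fun b : Fin 6 => φ j (nk j).row b.castSucc) (φ j (nk j).row 6)
    (neckG nk ξ ζ o fun i => ¬ (i = j ∨ i = j + 1)) (rest_avoids nk ξ ζ j _ o)
    (fun p => Sum.inl (bcell p)) (fun b h => Sum.inl_ne_inr h) (fun σ s s' => (s, s') ∈ PsigS j (nk j).row σ)
    (fun x => Wn dL ξ ζ j (nk j).row o x) (fun x => toR (cb6 (winW dL) ξ ζ j (nk j).row o x))
    (fun x => sig (cb6 (winE dL) ξ ζ j (nk j).row o x))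
    (fun x => Wn_verts dL ξ ζ j _ o x)
    (fun x hx => Wn_reach hL dL ξ ζ j _ o x fun a b => ?_)
    (fun x => Wn dR ξ ζ j (nk j).row o x) (fun x => toR (cb6 (winW dR) ξ ζ j (nk j).row o x))
    (fun x => sig (cb6 (winE dR) ξ ζ j (nk j).row o x))
    (fun x => Wn_verts dR ξ ζ j _ o x)
    (fun x hx => Wn_reach hL dR ξ ζ j _ o x fun a b => ?_)
    (toR κ) (toR κ') (fun σ => ?_) Δ
  · exact check_closedL (hck (ξ (nk j).row) (ζ (nk j).row) (ξ ((nk j).row + 1)) (ζ ((nk j).row + 1))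
      (o.1 j) (o.1 (j + 1 + 1))) x (toR_ne_zero hx) a b
  · exact check_closedR (hck (ξ (nk j).row) (ζ (nk j).row) (ξ ((nk j).row + 1)) (ζ ((nk j).row + 1))
      (o.1 j) (o.1 (j + 1 + 1))) x (toR_ne_zero hx) a b
  · have := congrArg toR (check_transfer (hck (ξ (nk j).row) (ζ (nk j).row) (ξ ((nk j).row + 1))
      (ζ ((nk j).row + 1)) (o.1 j) (o.1 (j + 1 + 1))) σ)
    simpa only [map_mul, map_sum, apply_ite toR, map_zero, cb6] using this

/-! ### Rotation of the necklace -/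

/-- Shift of the level vertices by one. [folklore] -/
def θ : Vx L → Vx L := Sum.map id (· + 1)

/-- The level shift is injective. [folklore] -/
theorem θ_injective : Function.Injective (θ (L := L)) :=
  Sum.map_injective.2 ⟨fun _ _ h => h, fun _ _ h => add_right_cancel h⟩

/-- Shifting a piece one level up maps its edges by `θ`. [folklore] -/
theorem pEdges_shift (ξ ζ : ZMod L → Bool) (p : PD L) (clo chi : Bool) (bits : Bool × Bool)
    (i : Fin (L + 2)) :
    pEdges ξ ζ p clo chi bits (Sum.inr (i + 1)) (Sum.inr (i + 1 + 1)) =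
      (pEdges ξ ζ p clo chi bits (Sum.inr i) (Sum.inr (i + 1))).map (Prod.map θ θ) := by
  rw [pEdges, pEdges, pieceE_map]; rfl

/-- CYCLICITY: rotating the necklace by one position does not change its pinned weights. [folklore] -/
theorem pinnedN_rotate (nk : Neck L) (ξ ζ : ZMod L → Bool)
    (Δ : Set ((Fin 2 × ZMod L) × (Fin 2 × ZMod L))) :
    pinnedN (fun i => nk (i + 1)) ξ ζ Δ = pinnedN nk ξ ζ Δ := by
  classical
  let ρ : Cfg L ≃ Cfg L :=
    { toFun := fun cfg => (fun i => cfg.1 (i + 1), fun i => cfg.2 (i + 1))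
      invFun := fun cfg => (fun i => cfg.1 (i - 1), fun i => cfg.2 (i - 1))
      left_inv := fun cfg => by ext i <;> simp [sub_add_cancel]
      right_inv := fun cfg => by ext i <;> simp }
  unfold pinnedN
  refine (Fintype.sum_equiv ρ _ _ fun cfg => ?_).symm
  -- weights
  have hw : neckW (fun i => nk (i + 1)) ξ ζ (ρ cfg) = neckW nk ξ ζ cfg := by
    unfold neckW
    exact Fintype.prod_equiv (Equiv.addRight 1) _ _ fun i => rfl
  -- graphs
  have hG : neckG nk ξ ζ cfg (fun _ => True) = fromRel fun u v => ∃ a b, u = θ a ∧ v = θ b ∧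
      (a, b) ∈ neckE (fun i => nk (i + 1)) ξ ζ (ρ cfg) (fun _ => True) := by
    have key : ∀ u v : Vx L, (u, v) ∈ neckE nk ξ ζ cfg (fun _ => True) ↔ ∃ a b, u = θ a ∧ v = θ b ∧
        (a, b) ∈ neckE (fun i => nk (i + 1)) ξ ζ (ρ cfg) (fun _ => True) := by
      intro u v
      simp only [neckE, Set.mem_setOf_eq, true_and]
      constructor
      · rintro ⟨i, h⟩
        obtain ⟨i, rfl⟩ : ∃ i', i = i' + 1 := ⟨i - 1, (sub_add_cancel i 1).symm⟩
        rw [pEdges_shift, List.mem_map] at h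
        obtain ⟨⟨a, b⟩, hab, he⟩ := h
        simp only [Prod.map_apply, Prod.mk.injEq] at he
        exact ⟨a, b, he.1.symm, he.2.symm, i, hab⟩
      · rintro ⟨a, b, rfl, rfl, i, h⟩
        refine ⟨i + 1, ?_⟩
        rw [pEdges_shift, List.mem_map]
        exact ⟨(a, b), h, rfl⟩
    ext u v
    simp only [neckG, fromRel_adj]
    rw [key u v, key v u]
  have hD : diagOf (neckG (fun i => nk (i + 1)) ξ ζ (ρ cfg) fun _ => True) =
      diagOf (neckG nk ξ ζ cfg fun _ => True) := by
    ext pq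
    simp only [diagOf, Set.mem_setOf_eq]
    rw [hG]
    exact (reach_map_iff θ θ_injective (fun a b => (a, b) ∈ neckE (fun i => nk (i + 1)) ξ ζ (ρ cfg)
      fun _ => True) (Sum.inl (bcell pq.1)) (Sum.inl (bcell pq.2))).symm
  rw [hD, hw]

end Necklace

/-! ## §5 The bridge: the block of the vocabulary file is the start necklace -/

section Bridge

variable {L : ℕ}

/-- Row of a level in the start necklace (`L`, `L+1` both sit at row `0 = L`). [folklore] -/
def rowOf (L : ℕ) (i : Fin (L + 2)) : ZMod L := ((min i.val L : ℕ) : ZMod L)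

/-- The start necklace of column types `τ`: `L` double faces, then two identity pieces. [folklore] -/
def startNeck (τ : Fin 2 → Bool) : Neck L := fun i =>
  if i.val < L then ⟨.D (τ 0) (τ 1), (i.val : ZMod L)⟩ else ⟨.I, 0⟩

/-- Block colouring from the three column colourings, literally as in `pinnedWeight`. [folklore] -/
def colB (ξ η ζ : ZMod L → Bool) : Fin 3 × ZMod L → Bool :=
  fun x => (![ξ, η, ζ] : Fin 3 → ZMod L → Bool) x.1 x.2

/-- Block configuration ↦ necklace configuration. [folklore] -/
def ι (η : ZMod L → Bool) (a : Fin 2 × ZMod L → Bool) : Cfg L :=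
  (fun i => η (rowOf L i),
   fun i => if i.val < L then (a (0, (i.val : ZMod L)), a (1, (i.val : ZMod L))) else (false, false))

/-- No wrap-around below the last level. [folklore] -/
theorem val_succ_of_lt (i : Fin (L + 2)) (h : i.val < L + 1) : (i + 1).val = i.val + 1 := by
  rw [Fin.val_add, Fin.val_one, Nat.mod_eq_of_lt (by omega)]

/-- Rows of the first `L` levels. [folklore] -/
theorem rowOf_lt {i : Fin (L + 2)} (h : i.val < L) : rowOf L i = (i.val : ZMod L) := by
  simp [rowOf, Nat.min_eq_left h.le]

/-- Row of the successor of one of the first `L` levels. [folklore] -/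
theorem rowOf_succ_lt {i : Fin (L + 2)} (h : i.val < L) : rowOf L (i + 1) = (i.val : ZMod L) + 1 := by
  rw [rowOf, val_succ_of_lt i (by omega), Nat.min_eq_left (by omega), Nat.cast_succ]

/-- The two extra levels sit at row `0`. [folklore] -/
theorem rowOf_ge {i : Fin (L + 2)} (h : ¬ i.val < L) : rowOf L i = 0 := by
  rw [rowOf, Nat.min_eq_right (by omega), ZMod.natCast_self]

/-- So do their successors. [folklore] -/
theorem rowOf_succ_ge {i : Fin (L + 2)} (h : ¬ i.val < L) : rowOf L (i + 1) = 0 := by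
  rw [rowOf]
  rcases Nat.lt_or_ge i.val (L + 1) with h1 | h1
  · rw [val_succ_of_lt i h1, Nat.min_eq_right (by omega), ZMod.natCast_self]
  · have : i + 1 = 0 := Fin.ext (by rw [Fin.val_add, Fin.val_one, Fin.val_zero]; simp [show i.val = L + 1 by omega])
    rw [this, Fin.val_zero, Nat.min_eq_left (Nat.zero_le _), Nat.cast_zero]

end Bridge

end DX

/-- REGISTERED SUB-GOAL of part 3: cyclicity of the pinned necklace weights. [folklore] -/
theorem diagramExchange_rotate : ∀ {L : ℕ} (nk : DX.Neck L) (ξ ζ : ZMod L → Bool) (Δ : Set ((Fin 2 × ZMod L) × (Fin 2 × ZMod L))), DX.pinnedN (fun i => nk (i + 1)) ξ ζ Δ = DX.pinnedN nk ξ ζ Δ :=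
  DX.pinnedN_rotate

end Summit.CriticalPhenomena.CardyFormulaZ2.Theorems.IKLinearTransport.PinnedDiagramExchange
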